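import Literature.Computability.MetaComplexity.ListDecodableCode
import Literature.Computability.MetaComplexity.ListDecodableCodeSudan
import Literature.Computability.Complexity.IrreducibilityLLLPolyArith
import Literature.Computability.Complexity.IrreducibilityLLLGcd
import HarnessLib

/-!
# A polynomial-time list-decodable binary code (Hirahara 2018, Thm. 4.7), III: the outer decoder on coefficient lists

Topic `Literature/Computability/MetaComplexity`, third file of the vendoring of the list-decodable
code of S. Hirahara, *Non-black-box worst-case to average-case reductions within NP*, FOCS 2018 /
ECCC TR18-138, **Thm. 4.7** (the concatenation of a Reed–Solomon code with the Hadamard code, list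
decoded by Sudan's algorithm [Sud97]; `ListDecodableCode.lean` has the code and the inner layer,
`ListDecodableCodeSudan.lean` the ALGEBRA of the outer layer over an abstract field: interpolation,
Sudan's identity, multiplicity, Newton lifting from an advised simple point).

This file writes the outer layer as a FUNCTIONAL PROGRAM on coefficient lists — polynomials over
`𝔽_q` are `List ℤ` (low degree first, entries reduced into `[0, q)`), read in `(ZMod q)[X]` by
`LLLFactoring.toZMod q` (the dense arithmetic `padd`, `pmul`, `pmod`, `pnorm` of
`SumcheckPolyArith.lean` / `IrreducibilityLLLPolyArith.lean`), bivariate polynomials are lists of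
such rows (row `j` = the coefficient of `Yʲ`) — and proves that each step computes the
corresponding object of `ListDecodableCodeSudan.lean`:

* `LDC.bivL q rows` (the bivariate polynomial of a row list; `coeff_bivL`), `LDC.tabL I J w`
  (the coefficient table of a kernel vector `w`, column index `j·I + i`; `bivL_tabL = bivOfCoeffs`);
* `LDC.derivL q k rows` — the `k`-th `Y`-derivative on tables (`bivL_derivL`);
* `LDC.shiftL q β a` — the Taylor shift `X ↦ X + β` of a row by Horner's rule
  (`toZMod_shiftL = taylor β`), `LDC.bivL_map_shiftL` (rowwise shift = `map (taylorAlgHom β)`);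
* `LDC.hornerZ q a β` — the value `a(β)` (`cast_hornerZ`); `LDC.deltaL` — the number
  `δ = (∂_Y R)(0, v)` of Newton's iteration (`cast_deltaL`);
* `LDC.evalTruncL q N R g` — `R(Z, g(Z)) mod Z^N` by Horner's rule in `Y` with truncation
  (`cast_getD_evalTruncL`: its coefficients below `N` are those of `R.eval g`);
* `LDC.newtonRunL q N R a₀ δinv` — `N` steps of Newton's iteration (`toZMod_newtonRunL = newtonPoly`);
* `LDC.msgPoly q x` — the message polynomial `Σ xᵢ Xⁱ` over `𝔽_q` (`cast_symb : symb = msgPoly(β)`),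
  and `LDC.readBitsL` (reading the message back from a reduced coefficient list, `readBitsL_eq`).

Sizes (`Reduced`, lengths) are recorded for the machine-level file. Everything is proved; no
named fact is introduced.

## References

* S. Hirahara, ECCC TR18-138 (2018) / FOCS 2018, Thm. 4.7 [Hirahara2018].
* M. Sudan, *Decoding of Reed Solomon codes beyond the error-correction bound*, J. Complexity 13
  (1997) 180–193, §2.
* S. Arora, B. Barak, *Computational Complexity: A Modern Approach*, CUP 2009, §19.3–19.4
  [AroraBarakCC2009].
* D. E. Knuth, *The Art of Computer Programming*, Vol. 2, 3rd ed., 1998, §4.6.1, §4.6.4 (Horner's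
  rule, Taylor shift by repeated synthetic division) [KnuthTAOCP2]. Schoolbook; proved here.
-/

noncomputable section

namespace Literature.Computability.MetaComplexity

open Polynomial Finset Literature.Computability.Complexity Literature.Computability.Complexity.LLLFactoring
  Literature.Computability.Complexity.SumcheckMA
open scoped Polynomial.Bivariate

namespace LDC

variable {q : ℕ}

/-! ### Small list lemmas -/

/-- `toZMod` of an appended singleton: the new top coefficient. [folklore] -/
theorem toZMod_append_singleton (l : List ℤ) (c : ℤ) :
    toZMod q (l ++ [c]) = toZMod q l + C ((c : ℤ) : ZMod q) * X ^ l.length := by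
  ext j
  rw [coeff_toZMod, coeff_add, coeff_toZMod, coeff_C_mul_X_pow]
  rcases lt_trichotomy j l.length with h | rfl | h
  · rw [List.getD_append _ _ _ _ h, if_neg h.ne]; simp
  · rw [List.getD_append_right _ _ _ _ le_rfl, Nat.sub_self, List.getD_cons_zero, if_pos rfl,
      List.getD_eq_default _ _ le_rfl]; simp
  · rw [List.getD_append_right _ _ _ _ h.le, List.getD_eq_default _ _ (by simp; omega), if_neg h.ne',
      List.getD_eq_default _ _ h.le]; simp

/-- `toZMod` of a `map` over `range`: coefficient `i < n` is the `i`-th value. [folklore] -/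
theorem coeff_toZMod_map_range (f : ℕ → ℤ) (n i : ℕ) :
    (toZMod q ((List.range n).map f)).coeff i = if i < n then ((f i : ℤ) : ZMod q) else 0 := by
  rw [coeff_toZMod, List.getD_eq_getElem?_getD, List.getElem?_map]
  by_cases hi : i < n
  · rw [List.getElem?_range hi, if_pos hi]; rfl
  · rw [List.getElem?_eq_none (by simpa using hi), if_neg hi]; simp

/-- Casting a reduced entry characterises it: equal casts of entries in `[0, q)` are equal. [folklore] -/
theorem eq_of_reduced_of_cast_eq {c d : ℤ} (hc : 0 ≤ c ∧ c < q) (hd : 0 ≤ d ∧ d < q)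
    (h : ((c : ℤ) : ZMod q) = ((d : ℤ) : ZMod q)) : c = d :=
  eq_of_cast_eq_of_reduced hc hd h

/-- Entries of a reduced list (default `0`) lie in `[0, q)` (`q ≥ 1`). [folklore] -/
theorem getD_reduced {l : List ℤ} (hl : Reduced q l) (hq : 0 < q) (i : ℕ) : 0 ≤ l.getD i 0 ∧ l.getD i 0 < q := by
  by_cases hi : i < l.length
  · rw [List.getD_eq_getElem _ _ hi]; exact hl _ (List.getElem_mem hi)
  · rw [List.getD_eq_default _ _ (not_lt.1 hi)]; exact ⟨le_rfl, by exact_mod_cast hq⟩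

/-! ### Bivariate polynomials as row lists -/

/-- **The bivariate polynomial of a row list**: row `j` is the coefficient of `Yʲ`.
[cite: AroraBarakCC2009, §19 (the interpolating polynomial `Q(x, y) = Σ Q_{ij} xⁱ yʲ`)] -/
def bivL (q : ℕ) : List (List ℤ) → (ZMod q)[X][Y]
  | [] => 0
  | r :: rs => C (toZMod q r) + Y * bivL q rs

/-- `bivL` of the empty list. [folklore] -/
@[simp] theorem bivL_nil : bivL q [] = 0 := rfl

/-- `bivL` of a cons. [folklore] -/
theorem bivL_cons (r : List ℤ) (rs : List (List ℤ)) : bivL q (r :: rs) = C (toZMod q r) + Y * bivL q rs := rfl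

/-- The `Y`-coefficients of `bivL`. [folklore] -/
theorem coeff_bivL : ∀ (rows : List (List ℤ)) (j : ℕ), (bivL q rows).coeff j = toZMod q (rows.getD j [])
  | [], j => by simp
  | r :: rs, 0 => by simp [bivL_cons]
  | r :: rs, j + 1 => by
    rw [bivL_cons, coeff_add, coeff_C, if_neg (Nat.succ_ne_zero j), zero_add, coeff_X_mul, coeff_bivL rs j]
    simp

/-- The `Y`-degree of `bivL rows` is `< |rows|`. [folklore] -/
theorem degree_bivL_lt (rows : List (List ℤ)) : (bivL q rows).degree < rows.length := by
  rcases eq_or_ne (bivL q rows) 0 with h | h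
  · rw [h, degree_zero]; exact WithBot.bot_lt_coe _
  · rw [degree_eq_natDegree h, Nat.cast_lt]
    by_contra hle
    have := coeff_bivL (q := q) rows (bivL q rows).natDegree
    rw [List.getD_eq_default _ _ (not_lt.1 hle), toZMod_nil] at this
    exact absurd this (leadingCoeff_ne_zero.2 h)

/-- **The coefficient table of a vector**: row `j < J` lists `w_{jI}, …, w_{jI + I - 1}`.
[cite: AroraBarakCC2009, §19 (the unknowns `Q_{ij}` of the interpolation step)] -/
def tabL (I J : ℕ) (w : List ℤ) : List (List ℤ) :=
  (List.range J).map fun j => (List.range I).map fun i => w.getD (j * I + i) 0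

/-- `tabL` has `J` rows. [folklore] -/
@[simp] theorem length_tabL (I J : ℕ) (w : List ℤ) : (tabL I J w).length = J := by simp [tabL]

/-- Every row of `tabL` has length `I`. [folklore] -/
theorem length_of_mem_tabL {I J : ℕ} {w : List ℤ} {r : List ℤ} (h : r ∈ tabL I J w) : r.length = I := by
  obtain ⟨j, -, rfl⟩ := List.mem_map.1 h; simp

/-- **`bivL (tabL I J w)` is the interpolating polynomial `bivOfCoeffs I J c` with `c i j = w_{jI+i}`.**
[cite: AroraBarakCC2009, §19] -/
theorem bivL_tabL (I J : ℕ) (w : List ℤ) :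
    bivL q (tabL I J w) = bivOfCoeffs I J (fun i j => ((w.getD (j * I + i) 0 : ℤ) : ZMod q)) := by
  ext j i
  rw [coeff_bivL, coeff_coeff_bivOfCoeffs, tabL, List.getD_eq_getElem?_getD, List.getElem?_map]
  by_cases hj : j < J
  · rw [List.getElem?_range hj, Option.map_some, Option.getD_some, coeff_toZMod_map_range]
    by_cases hi : i < I
    · rw [if_pos hi, if_pos ⟨hi, hj⟩]
    · rw [if_neg hi, if_neg (fun h => hi h.1)]
  · rw [List.getElem?_eq_none (by simpa using hj), Option.map_none, Option.getD_none, toZMod_nil, coeff_zero,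
      if_neg (fun h => hj h.2)]

/-- The rows of `tabL` of a reduced vector are reduced. [folklore] -/
theorem reduced_of_mem_tabL {I J : ℕ} {w : List ℤ} (hw : Reduced q w) (hq : 0 < q) {r : List ℤ} (h : r ∈ tabL I J w) :
    Reduced q r := by
  obtain ⟨j, -, rfl⟩ := List.mem_map.1 h
  intro c hc
  obtain ⟨i, -, rfl⟩ := List.mem_map.1 hc
  exact getD_reduced hw hq _

/-! ### `Y`-derivatives on tables -/

/-- **The `k`-th `Y`-derivative on row lists**: row `j` becomes `(j+1)⋯(j+k) · row_{j+k}`, reduced.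
[cite: Hirahara2018, Thm. 4.7 (decoding; here the multiplicity step of the advice form)] -/
def derivL (q k : ℕ) (rows : List (List ℤ)) : List (List ℤ) :=
  (List.range (rows.length - k)).map fun j => pmod q (pscale ((j + k).descFactorial k) (rows.getD (j + k) []))

/-- `derivL` has `|rows| - k` rows. [folklore] -/
@[simp] theorem length_derivL (k : ℕ) (rows : List (List ℤ)) : (derivL q k rows).length = rows.length - k := by
  simp [derivL]

/-- **`bivL (derivL k rows) = ∂_Y^k (bivL rows)`.** [folklore] -/
theorem bivL_derivL (k : ℕ) (rows : List (List ℤ)) : bivL q (derivL q k rows) = derivative^[k] (bivL q rows) := by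
  ext j : 1
  rw [coeff_bivL, coeff_iterate_derivative, coeff_bivL, derivL, List.getD_eq_getElem?_getD, List.getElem?_map]
  by_cases hj : j < rows.length - k
  · rw [List.getElem?_range hj, Option.map_some, Option.getD_some, toZMod_pmod, toZMod_pscale, nsmul_eq_mul]
    congr 1
    simp
  · rw [List.getElem?_eq_none (by simpa using hj), Option.map_none, Option.getD_none, toZMod_nil,
      List.getD_eq_default _ _ (by omega), toZMod_nil, smul_zero]

/-- Rows of `derivL` are reduced (`q ≥ 1`). [folklore] -/
theorem reduced_of_mem_derivL (hq : 0 < q) {k : ℕ} {rows : List (List ℤ)} {r : List ℤ} (h : r ∈ derivL q k rows) :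
    Reduced q r := by
  obtain ⟨j, -, rfl⟩ := List.mem_map.1 h
  exact reduced_pmod hq _

/-- Rows of `derivL` are no longer than the longest input row. [folklore] -/
theorem length_of_mem_derivL {k W : ℕ} {rows : List (List ℤ)} (hW : ∀ r ∈ rows, r.length ≤ W) {r : List ℤ}
    (h : r ∈ derivL q k rows) : r.length ≤ W := by
  obtain ⟨j, -, rfl⟩ := List.mem_map.1 h
  rw [length_pmod, pscale, List.length_map]
  by_cases hj : j + k < rows.length
  · rw [List.getD_eq_getElem _ _ hj]; exact hW _ (List.getElem_mem hj)
  · rw [List.getD_eq_default _ _ (not_lt.1 hj)]; exact Nat.zero_le _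


/-! ### The Taylor shift of a row by Horner's rule -/

/-- One Horner step of the shift: `acc ↦ c + (X + β)·acc`, normalised modulo `q`. [cite: KnuthTAOCP2, §4.6.4] -/
def shiftStepL (q : ℕ) (β c : ℤ) (acc : List ℤ) : List ℤ := pnorm q (padd [c] (pmul [β, 1] acc))

/-- **The Taylor shift `a(X) ↦ a(X + β)`** of a coefficient list, by Horner's rule
(`a₀ + (X+β)(a₁ + (X+β)(⋯))`). [cite: KnuthTAOCP2, §4.6.4 (Taylor shift by repeated synthetic division)] -/
def shiftL (q : ℕ) (β : ℤ) (a : List ℤ) : List ℤ := a.foldr (shiftStepL q β) []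

/-- `toZMod [β, 1] = X + β`. [folklore] -/
theorem toZMod_linear (β : ℤ) : toZMod q [β, 1] = X + C ((β : ℤ) : ZMod q) := by
  rw [toZMod_cons, toZMod_cons, toZMod_nil]; simp; ring

/-- Semantics of one Horner step. [folklore] -/
theorem toZMod_shiftStepL (β c : ℤ) (acc : List ℤ) :
    toZMod q (shiftStepL q β c acc) = C ((c : ℤ) : ZMod q) + (X + C ((β : ℤ) : ZMod q)) * toZMod q acc := by
  rw [shiftStepL, toZMod_pnorm, toZMod_padd, toZMod_pmul, toZMod_linear, toZMod_cons, toZMod_nil]; simp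

/-- **`shiftL` computes the composition with `X + β`.** [cite: KnuthTAOCP2, §4.6.4] -/
theorem toZMod_shiftL (β : ℤ) : ∀ a : List ℤ, toZMod q (shiftL q β a) = (toZMod q a).comp (X + C ((β : ℤ) : ZMod q))
  | [] => by simp [shiftL]
  | c :: a => by
    rw [shiftL, List.foldr_cons, ← shiftL, toZMod_shiftStepL, toZMod_shiftL β a, toZMod_cons]
    simp [add_comp, mul_comp]

/-- **`shiftL` is Mathlib's `taylor`.** [folklore] -/
theorem toZMod_shiftL_eq_taylor (β : ℤ) (a : List ℤ) : toZMod q (shiftL q β a) = taylor ((β : ℤ) : ZMod q) (toZMod q a) := by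
  rw [toZMod_shiftL, taylor_apply]

/-- `shiftL` returns a normal list (`q ≥ 1`). [folklore] -/
theorem normal_shiftL (hq : 0 < q) (β : ℤ) : ∀ a : List ℤ, a ≠ [] → Normal q (shiftL q β a)
  | [], h => absurd rfl h
  | _ :: _, _ => normal_pnorm hq _

/-- `shiftL` returns a reduced list (`q ≥ 1`). [folklore] -/
theorem reduced_shiftL (hq : 0 < q) (β : ℤ) (a : List ℤ) : Reduced q (shiftL q β a) := by
  cases a with
  | nil => intro c hc; simp [shiftL] at hc
  | cons c a => exact (normal_shiftL hq β (c :: a) (List.cons_ne_nil _ _)).1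

/-- A normal list is no longer than any list with the same polynomial. [folklore] -/
theorem length_le_of_normal_of_toZMod_eq {a b : List ℤ} (ha : Normal q a) (h : toZMod q a = toZMod q b) : a.length ≤ b.length := by
  rcases eq_or_ne a [] with rfl | hne
  · exact Nat.zero_le _
  · have hd := (ha.natDegree_toZMod hne).1
    have hlt := degree_toZMod_lt (M := q) b
    have h0 : toZMod q a ≠ 0 := fun h0 => hne (ha.toZMod_eq_zero_iff.1 h0)
    rw [← h, degree_eq_natDegree h0, hd, Nat.cast_lt] at hlt
    omega

/-- **The shift does not lengthen**: `|shiftL q β a| ≤ |a|` (`q ≥ 1`). [folklore] -/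
theorem length_shiftL_le (hq : 0 < q) (β : ℤ) (a : List ℤ) : (shiftL q β a).length ≤ a.length := by
  rcases eq_or_ne a [] with rfl | hne
  · simp [shiftL]
  · -- compare with the (untrimmed) list of the Taylor coefficients, of length `|a|`
    have hn := normal_shiftL hq β a hne
    set T := taylor ((β : ℤ) : ZMod q) (toZMod q a) with hT
    have hdeg : T.degree < a.length := by rw [hT, degree_taylor]; exact degree_toZMod_lt a
    refine (length_le_of_normal_of_toZMod_eq hn (b := (List.range a.length).map fun i => ((T.coeff i).val : ℤ)) ?_).trans (by simp)
    rw [toZMod_shiftL_eq_taylor]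
    ext i
    rw [coeff_toZMod_map_range]
    by_cases hi : i < a.length
    · rw [if_pos hi, ← hT]
      haveI : NeZero q := ⟨hq.ne'⟩
      simp
    · rw [if_neg hi, ← hT]
      exact coeff_eq_zero_of_degree_lt (hdeg.trans_le (by exact_mod_cast not_lt.1 hi))

/-- **Rowwise shift = `map (taylorAlgHom β)`** on the bivariate polynomial. [folklore] -/
theorem bivL_map_shiftL (β : ℤ) : ∀ rows : List (List ℤ),
    bivL q (rows.map (shiftL q β)) = (bivL q rows).map (taylorAlgHom ((β : ℤ) : ZMod q) : (ZMod q)[X] →+* (ZMod q)[X])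
  | [] => by simp
  | r :: rs => by
    rw [List.map_cons, bivL_cons, bivL_cons, bivL_map_shiftL β rs, Polynomial.map_add, Polynomial.map_mul, map_C, map_X,
      toZMod_shiftL_eq_taylor]
    rfl

/-! ### Horner evaluation of a row at a point -/

/-- **The value `a(β) mod q`** by Horner's rule on integers. [cite: KnuthTAOCP2, §4.6.4 (Horner's rule)] -/
def hornerZ (q : ℕ) (a : List ℤ) (β : ℤ) : ℤ := a.foldr (fun c acc => (c + β * acc) % (q : ℤ)) 0

/-- `hornerZ` of a cons. [folklore] -/
theorem hornerZ_cons (c : ℤ) (a : List ℤ) (β : ℤ) : hornerZ q (c :: a) β = (c + β * hornerZ q a β) % (q : ℤ) := rfl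

/-- **`hornerZ` computes the value of the polynomial.** [folklore] -/
theorem cast_hornerZ (β : ℤ) : ∀ a : List ℤ, ((hornerZ q a β : ℤ) : ZMod q) = (toZMod q a).eval ((β : ℤ) : ZMod q)
  | [] => by simp [hornerZ]
  | c :: a => by
    rw [hornerZ_cons, ZMod.intCast_mod, toZMod_cons]
    push_cast
    rw [cast_hornerZ β a]
    simp

/-- `hornerZ` is reduced (`q ≥ 1`). [folklore] -/
theorem hornerZ_bounds (hq : 0 < q) (a : List ℤ) (β : ℤ) : 0 ≤ hornerZ q a β ∧ hornerZ q a β < q := by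
  have hq' : (0 : ℤ) < q := by exact_mod_cast hq
  cases a with
  | nil => exact ⟨le_rfl, hq'⟩
  | cons c a => exact ⟨Int.emod_nonneg _ hq'.ne', Int.emod_lt_of_pos _ hq'⟩

/-- The value at `(0, v)` of a bivariate polynomial is the Horner value at `v` of the list of the
constant coefficients of its rows. [folklore] -/
theorem evalEval_zero_bivL (v : ℤ) : ∀ rows : List (List ℤ),
    (bivL q rows).evalEval 0 ((v : ℤ) : ZMod q) = ((hornerZ q (rows.map fun r => r.getD 0 0) v : ℤ) : ZMod q)
  | [] => by simp [hornerZ]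
  | r :: rs => by
    rw [bivL_cons, List.map_cons, hornerZ_cons, ZMod.intCast_mod]
    push_cast
    rw [← evalEval_zero_bivL v rs, evalEval, evalEval, eval_add, eval_mul, eval_C, eval_X, eval_add, eval_mul,
      ← coeff_zero_eq_eval_zero, coeff_toZMod, eval_C]

/-- **The Newton denominator `δ = (∂_Y R)(0, v)`** on row lists. [cite: Hirahara2018, Thm. 4.7 (decoding)] -/
def deltaL (q : ℕ) (R : List (List ℤ)) (v : ℤ) : ℤ := hornerZ q ((derivL q 1 R).map fun r => r.getD 0 0) v

/-- **`deltaL` computes `(∂_Y R)(0, v)`.** [folklore] -/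
theorem cast_deltaL (R : List (List ℤ)) (v : ℤ) :
    ((deltaL q R v : ℤ) : ZMod q) = (derivative (bivL q R)).evalEval 0 ((v : ℤ) : ZMod q) := by
  rw [deltaL, ← evalEval_zero_bivL, bivL_derivL, Function.iterate_one]

/-- `deltaL` is reduced (`q ≥ 1`). [folklore] -/
theorem deltaL_bounds (hq : 0 < q) (R : List (List ℤ)) (v : ℤ) : 0 ≤ deltaL q R v ∧ deltaL q R v < q :=
  hornerZ_bounds hq _ _


/-! ### Truncated evaluation `R(Z, g(Z)) mod Z^N` -/

/-- One Horner step in `Y`: `acc ↦ (row + g · acc) mod (q, Z^N)`. [cite: KnuthTAOCP2, §4.6.4] -/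
def evalTruncStepL (q N : ℕ) (g row acc : List ℤ) : List ℤ := pmod q ((padd row (pmul g acc)).take N)

/-- **`R(Z, g(Z))` truncated at degree `N`**, by Horner's rule in `Y` over the rows of `R`.
[cite: Hirahara2018, Thm. 4.7 (decoding; Newton's iteration evaluates `R(Z, g_m(Z))`)] -/
def evalTruncL (q N : ℕ) (R : List (List ℤ)) (g : List ℤ) : List ℤ := R.foldr (evalTruncStepL q N g) []

/-- Every step returns a reduced list of length `≤ N` (`q ≥ 1`). [folklore] -/
theorem evalTruncStepL_size (hq : 0 < q) (N : ℕ) (g row acc : List ℤ) :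
    Reduced q (evalTruncStepL q N g row acc) ∧ (evalTruncStepL q N g row acc).length ≤ N :=
  ⟨reduced_pmod hq _, by rw [evalTruncStepL, length_pmod, List.length_take]; exact min_le_left _ _⟩

/-- `evalTruncL` returns a reduced list of length `≤ N` (`q ≥ 1`). [folklore] -/
theorem evalTruncL_size (hq : 0 < q) (N : ℕ) (g : List ℤ) : ∀ R : List (List ℤ),
    Reduced q (evalTruncL q N R g) ∧ (evalTruncL q N R g).length ≤ N
  | [] => ⟨fun c hc => by simp [evalTruncL] at hc, by simp [evalTruncL]⟩
  | row :: R => evalTruncStepL_size hq N g row _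

/-- Coefficients below `N` of a product depend only on the coefficients below `N` of the factors.
[folklore] -/
theorem coeff_mul_congr_of_lt {K : Type*} [CommSemiring K] {N : ℕ} (g : K[X]) {A A' : K[X]}
    (h : ∀ m < N, A.coeff m = A'.coeff m) {m : ℕ} (hm : m < N) : (g * A).coeff m = (g * A').coeff m := by
  rw [coeff_mul, coeff_mul]
  refine sum_congr rfl fun ij hij => ?_
  rw [HasAntidiagonal.mem_antidiagonal] at hij
  rw [h ij.2 (by omega)]

/-- `toZMod` of a truncation: coefficients below `N` are unchanged. [folklore] -/
theorem coeff_toZMod_take_of_lt {N : ℕ} (l : List ℤ) {m : ℕ} (hm : m < N) : (toZMod q (l.take N)).coeff m = (toZMod q l).coeff m := by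
  rw [coeff_toZMod, coeff_toZMod, List.getD_eq_getElem?_getD, List.getElem?_take, if_pos hm, ← List.getD_eq_getElem?_getD]

/-- **`evalTruncL` computes the low coefficients of `R(Z, g(Z))`**: for `m < N`, entry `m` is the
`m`-th coefficient of `(bivL R).eval (toZMod g)`. [folklore] -/
theorem coeff_toZMod_evalTruncL (N : ℕ) (g : List ℤ) : ∀ (R : List (List ℤ)) {m : ℕ}, m < N →
    (toZMod q (evalTruncL q N R g)).coeff m = ((bivL q R).eval (toZMod q g)).coeff m
  | [], m, _ => by simp [evalTruncL]
  | row :: R, m, hm => by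
    rw [evalTruncL, List.foldr_cons, ← evalTruncL, evalTruncStepL, toZMod_pmod, coeff_toZMod_take_of_lt _ hm, toZMod_padd,
      toZMod_pmul, bivL_cons, eval_add, eval_mul, eval_C, eval_X, coeff_add, coeff_add]
    congr 1
    exact coeff_mul_congr_of_lt _ (fun m' hm' => coeff_toZMod_evalTruncL N g R hm') hm

/-- The entry read by Newton's iteration. [folklore] -/
theorem cast_getD_evalTruncL {N : ℕ} (R : List (List ℤ)) (g : List ℤ) {m : ℕ} (hm : m < N) :
    (((evalTruncL q N R g).getD m 0 : ℤ) : ZMod q) = ((bivL q R).eval (toZMod q g)).coeff m := by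
  rw [← coeff_toZMod_evalTruncL N g R hm, coeff_toZMod]

/-! ### Newton's iteration on lists -/

/-- **The next Taylor coefficient**: `a₀` at step `0`, else `-[Z^m] R(Z, g(Z)) · δ⁻¹`, reduced.
[cite: Hirahara2018, Thm. 4.7 (decoding, advice form: Newton lifting from the advised point)] -/
def newtonStepL (q N : ℕ) (R : List (List ℤ)) (a₀ δinv : ℤ) (g : List ℤ) (m : ℕ) : ℤ :=
  if m = 0 then a₀ % (q : ℤ) else (-((evalTruncL q N R g).getD m 0) * δinv) % (q : ℤ)

/-- **`N` steps of Newton's iteration**: the list of the first `N` Taylor coefficients.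
[cite: Hirahara2018, Thm. 4.7 (decoding, advice form)] -/
def newtonRunL (q N : ℕ) (R : List (List ℤ)) (a₀ δinv : ℤ) : List ℤ :=
  (List.range N).foldl (fun g m => g ++ [newtonStepL q N R a₀ δinv g m]) []

/-- The state after the first `k` steps. [folklore] -/
def newtonPrefixL (q N : ℕ) (R : List (List ℤ)) (a₀ δinv : ℤ) (k : ℕ) : List ℤ :=
  (List.range k).foldl (fun g m => g ++ [newtonStepL q N R a₀ δinv g m]) []

/-- `newtonRunL` is the `N`-th prefix state. [folklore] -/
theorem newtonRunL_eq (N : ℕ) (R : List (List ℤ)) (a₀ δinv : ℤ) : newtonRunL q N R a₀ δinv = newtonPrefixL q N R a₀ δinv N := rfl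

/-- The prefix states grow by one coefficient. [folklore] -/
theorem newtonPrefixL_succ (N : ℕ) (R : List (List ℤ)) (a₀ δinv : ℤ) (k : ℕ) :
    newtonPrefixL q N R a₀ δinv (k + 1) =
      newtonPrefixL q N R a₀ δinv k ++ [newtonStepL q N R a₀ δinv (newtonPrefixL q N R a₀ δinv k) k] := by
  rw [newtonPrefixL, List.range_succ, List.foldl_append, List.foldl_cons, List.foldl_nil, ← newtonPrefixL]

/-- The `k`-th prefix state has length `k`. [folklore] -/
theorem length_newtonPrefixL (N : ℕ) (R : List (List ℤ)) (a₀ δinv : ℤ) : ∀ k, (newtonPrefixL q N R a₀ δinv k).length = k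
  | 0 => rfl
  | k + 1 => by rw [newtonPrefixL_succ, List.length_append, length_newtonPrefixL N R a₀ δinv k]; rfl

/-- Every step is reduced (`q ≥ 1`). [folklore] -/
theorem newtonStepL_bounds (hq : 0 < q) (N : ℕ) (R : List (List ℤ)) (a₀ δinv : ℤ) (g : List ℤ) (m : ℕ) :
    0 ≤ newtonStepL q N R a₀ δinv g m ∧ newtonStepL q N R a₀ δinv g m < q := by
  have hq' : (0 : ℤ) < q := by exact_mod_cast hq
  unfold newtonStepL
  split_ifs <;> exact ⟨Int.emod_nonneg _ hq'.ne', Int.emod_lt_of_pos _ hq'⟩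

/-- The prefix states are reduced (`q ≥ 1`). [folklore] -/
theorem reduced_newtonPrefixL (hq : 0 < q) (N : ℕ) (R : List (List ℤ)) (a₀ δinv : ℤ) : ∀ k, Reduced q (newtonPrefixL q N R a₀ δinv k)
  | 0 => fun c hc => by simp [newtonPrefixL] at hc
  | k + 1 => by
    rw [newtonPrefixL_succ]
    intro c hc
    rcases List.mem_append.1 hc with h | h
    · exact reduced_newtonPrefixL hq N R a₀ δinv k c h
    · rw [List.mem_singleton.1 h]; exact newtonStepL_bounds hq N R a₀ δinv _ _

/-- **`newtonRunL` is reduced and has length `N`** (`q ≥ 1`). [folklore] -/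
theorem newtonRunL_size (hq : 0 < q) (N : ℕ) (R : List (List ℤ)) (a₀ δinv : ℤ) :
    Reduced q (newtonRunL q N R a₀ δinv) ∧ (newtonRunL q N R a₀ δinv).length = N :=
  ⟨reduced_newtonPrefixL hq N R a₀ δinv N, length_newtonPrefixL N R a₀ δinv N⟩

/-- **The prefix states are the partial polynomials of Newton's iteration** (`ListDecodableCodeSudan.lean`,
`LDC.newtonPoly`), for `k ≤ N`. [folklore] -/
theorem toZMod_newtonPrefixL (N : ℕ) (R : List (List ℤ)) (a₀ δinv : ℤ) : ∀ {k : ℕ}, k ≤ N →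
    toZMod q (newtonPrefixL q N R a₀ δinv k) = newtonPoly (bivL q R) ((a₀ : ℤ) : ZMod q) ((δinv : ℤ) : ZMod q) k
  | 0, _ => by simp [newtonPrefixL, newtonPoly]
  | k + 1, hk => by
    rw [newtonPrefixL_succ, toZMod_append_singleton, length_newtonPrefixL, newtonPoly,
      toZMod_newtonPrefixL N R a₀ δinv (Nat.le_of_succ_le hk)]
    congr 2
    rw [newtonStepL, newtonNext]
    by_cases h0 : k = 0
    · rw [if_pos h0, if_pos h0, ZMod.intCast_mod]
    · rw [if_neg h0, if_neg h0, ZMod.intCast_mod, Int.cast_mul, Int.cast_neg, cast_getD_evalTruncL _ _ hk,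
        toZMod_newtonPrefixL N R a₀ δinv (Nat.le_of_succ_le hk)]

/-- **`newtonRunL` computes `newtonPoly … N`.** [cite: Hirahara2018, Thm. 4.7 (decoding, advice form)] -/
theorem toZMod_newtonRunL (N : ℕ) (R : List (List ℤ)) (a₀ δinv : ℤ) :
    toZMod q (newtonRunL q N R a₀ δinv) = newtonPoly (bivL q R) ((a₀ : ℤ) : ZMod q) ((δinv : ℤ) : ZMod q) N :=
  toZMod_newtonPrefixL N R a₀ δinv le_rfl

/-! ### The message polynomial and reading the message back -/

/-- The coefficient list of a message: bits as `0/1`. [cite: AroraBarakCC2009, §19.3 (Reed–Solomon: the message as coefficients)] -/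
def msgCoeffs (x : List Bool) : List ℤ := x.map fun b => if b then 1 else 0

/-- **The message polynomial `p_x = Σ xᵢ Xⁱ` over `𝔽_q`.** [cite: AroraBarakCC2009, §19.3] -/
def msgPoly (q : ℕ) (x : List Bool) : (ZMod q)[X] := toZMod q (msgCoeffs x)

/-- `msgPoly` has degree `< |x|`. [folklore] -/
theorem degree_msgPoly_lt (x : List Bool) : (msgPoly q x).degree < x.length := by
  have h := degree_toZMod_lt (M := q) (msgCoeffs x)
  rwa [msgCoeffs, List.length_map] at h

/-- `msgPoly` has `natDegree ≤ |x| - 1`. [folklore] -/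
theorem natDegree_msgPoly_le (x : List Bool) : (msgPoly q x).natDegree ≤ x.length - 1 := by
  rcases eq_or_ne (msgPoly q x) 0 with h | h
  · rw [h, natDegree_zero]; exact Nat.zero_le _
  · have hd := degree_msgPoly_lt (q := q) x
    rw [degree_eq_natDegree h, Nat.cast_lt] at hd
    omega

/-- The coefficients of `msgPoly`. [folklore] -/
theorem coeff_msgPoly (x : List Bool) (i : ℕ) : (msgPoly q x).coeff i = if x.getD i false then 1 else 0 := by
  rw [msgPoly, coeff_toZMod, msgCoeffs, List.getD_eq_getElem?_getD, List.getElem?_map, List.getD_eq_getElem?_getD]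
  cases x[i]? with
  | none => simp
  | some b => cases b <;> simp

/-- **The Reed–Solomon symbol is the value of the message polynomial**: `symb q x β = p_x(β)` in `𝔽_q`.
[cite: AroraBarakCC2009, §19.3] -/
theorem cast_symb (β : ℕ) : ∀ x : List Bool, ((symb q x β : ℕ) : ZMod q) = (msgPoly q x).eval (β : ZMod q)
  | [] => by simp [symb, msgPoly, msgCoeffs]
  | b :: x => by
    have ih := cast_symb β x
    rw [symb, List.foldr_cons, ← symb, ZMod.natCast_mod, msgPoly, msgCoeffs, List.map_cons, toZMod_cons, ← msgCoeffs, ← msgPoly]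
    push_cast
    rw [ih]
    cases b <;> simp

/-- **Reading the message off a coefficient list**: bit `i` is `[entry i = 1]`. [folklore] -/
def readBitsL (n : ℕ) (l : List ℤ) : List Bool := (List.range n).map fun i => decide (l.getD i 0 = 1)

/-- `readBitsL n l` has length `n`. [folklore] -/
@[simp] theorem length_readBitsL (n : ℕ) (l : List ℤ) : (readBitsL n l).length = n := by simp [readBitsL]

/-- **A reduced coefficient list of the message polynomial reads back the message** (`q ≥ 2`). [folklore] -/
theorem readBitsL_eq (hq : 2 ≤ q) {l : List ℤ} (hl : Reduced q l) {x : List Bool} (h : toZMod q l = msgPoly q x) :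
    readBitsL x.length l = x := by
  refine List.ext_getElem (by simp) fun i h1 h2 => ?_
  simp only [readBitsL, List.getElem_map, List.getElem_range]
  have hc := congrArg (fun P => P.coeff i) h
  simp only [coeff_toZMod, coeff_msgPoly, List.getD_eq_getElem _ _ h2] at hc
  have hred := getD_reduced hl (by omega) i
  have h1q : (0 : ℤ) ≤ 1 ∧ (1 : ℤ) < q := ⟨zero_le_one, by exact_mod_cast hq⟩
  have h0q : (0 : ℤ) ≤ 0 ∧ (0 : ℤ) < q := ⟨le_rfl, by exact_mod_cast (by omega : 0 < q)⟩
  cases hx : x[i] with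
  | true =>
    rw [hx] at hc
    have : l.getD i 0 = 1 := eq_of_reduced_of_cast_eq hred h1q (by rw [hc]; simp)
    rw [List.getD_eq_getElem?_getD] at this
    simp [this]
  | false =>
    rw [hx] at hc
    have : l.getD i 0 = 0 := eq_of_reduced_of_cast_eq hred h0q (by rw [hc]; simp)
    rw [List.getD_eq_getElem?_getD] at this
    simp [this]

end LDC

end Literature.Computability.MetaComplexity

end
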